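import Summits.AtomisticToContinuum.HydrodynamicLimit.Theorems.JParityClosureOddContactSymmetryKdeDefectTools
import Summits.AtomisticToContinuum.HydrodynamicLimit.Theorems.JParityClosureOddContactSymmetryWeightedKdeDev
import Summits.AtomisticToContinuum.HydrodynamicLimit.Theorems.JParityClosureOddContactSymmetryGaussKernelMoments
import Summits.AtomisticToContinuum.HydrodynamicLimit.Theorems.JParityClosureOddContactSymmetryTiltedPairExpMoment
import HarnessLib

/-!
# K1 glue: the flux-weighted Metropolis defect bound from K1b and K1d (line `KineticSlabSketch`, piece K1 of P4)

Crux `JParityClosure.OddContactSymmetry` (stmt-AtomisticToContinuum-17722, rev 5), line `KineticSlabSketch`, lead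
`prover-line-stmt-AtomisticToContinuum-17722-c2-0` (cycle 3).  `kdeDefectPair_of : K1b → K1d → K1`: under the product Maxwellian
law of `n` velocities, with fixed non-negative kernel weights `p_k ≤ pmax` and off-pair mass `P = Σ_{k ∉ {i,j}} p_k`, the
flux-weighted mean of the Metropolis acceptance defect of the weighted Gaussian KDE read at the four velocities of the collision
of the pair `(i, j)` is at most `B(θ,ϑ)(√(pmax/P) + pmax/P)` times the flux normalisation.  Pointwise control by
`defect_pointwise_le`; the off-pair coordinates are integrated out with K1b (`lmarginal_dev_le`,
`MeasureTheory.lintegral_le_of_lmarginal_le`); the Gaussian ratios at the four velocities are dominated by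
`exp((‖v_i‖² + ‖v_j‖²)/(2(θ+ϑ²)))` (`devScale_le`, `spike_div_le`, `norm_sq_four_le`), whose flux-tilted expectation is the
scaling identity K1d.
-/

noncomputable section

open scoped BigOperators Classical InnerProductSpace ENNReal Topology
open Set MeasureTheory Filter Function
open Literature.Analysis.FluidPDE Literature.MathematicalPhysics.KineticTheory

namespace Summit.AtomisticToContinuum.HydrodynamicLimit.Theorems.OddContactSymmetryKineticSlab

/-! ## Step 5: the K1 glue -/

/-- **K1 from K1a + K1b + K1d** (piece K1 of P4, the velocity-level core): the flux-weighted mean of the Metropolis acceptance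
defect of the weighted Gaussian KDE is at most `B(θ,ϑ) (√(pmax/P) + pmax/P)` times the flux normalisation, `P` the off-pair
weight mass.  Pointwise `δ ≤ 2Σ_q|Δ_q| + Σ_pre(2|Δ_q| + 2S/m̄(q))` (`defect_pointwise_le`); integrate out the off-pair
coordinates with K1b at each of the four query points (`lmarginal_dev_le`, `lintegral_le_of_lmarginal_le`); bound the
resulting Gaussian ratios by `exp(c₀(‖v_i‖² + ‖v_j‖²))`, `c₀ = 1/(2(θ+ϑ²))` (`devScale_le`, `spike_div_le`,
`norm_sq_four_le`); finish with the tilted exponential moment K1d. [folklore] -/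
theorem kdeDefectPair_of
    (hB : ∀ {κ : Type} [Fintype κ] {θ ϑ : ℝ} (_hθ : 0 < θ) (_hϑ : 0 < ϑ) {p : κ → ℝ} {pmax : ℝ}
          (_hp0 : ∀ k, 0 ≤ p k) (_hpm : ∀ k, p k ≤ pmax) (_hP : 0 < ∑ k, p k) (q : V3),
          ∫ v, |(∑ k, p k * localMaxwellian 1 (ϑ ^ 2) q (v k)) /
                ((∑ k, p k) * localMaxwellian 1 (θ + ϑ ^ 2) 0 q) - 1|
              ∂(Measure.pi fun _ : κ => gaussMeasure (0 : V3) θ) ≤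
            Real.sqrt (pmax / ∑ k, p k) *
              (Real.sqrt ((4 * Real.pi * ϑ ^ 2) ^ (-(3 : ℝ) / 2) * localMaxwellian 1 (θ + ϑ ^ 2 / 2) 0 q) /
                localMaxwellian 1 (θ + ϑ ^ 2) 0 q))
    (hD : ∀ {θ c : ℝ} (_hθ : 0 < θ) (_hc : 0 ≤ c) (_hcθ : c < 1 / (2 * θ)) {n : ℕ} {i j : Fin n} (_hij : i ≠ j) (ω : V3),
          ∫⁻ v, ENNReal.ofReal (max ⟪ω, v i - v j⟫_ℝ 0 * Real.exp (c * (‖v i‖ ^ 2 + ‖v j‖ ^ 2)))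
              ∂(Measure.pi fun _ : Fin n => gaussMeasure (0 : V3) θ) =
            ENNReal.ofReal ((1 - 2 * c * θ) ^ (-(7 : ℝ) / 2)) *
              ∫⁻ v, ENNReal.ofReal (max ⟪ω, v i - v j⟫_ℝ 0) ∂(Measure.pi fun _ : Fin n => gaussMeasure (0 : V3) θ)) :
    ∀ {θ ϑ : ℝ} (_hθ : 0 < θ) (_hϑ : 0 < ϑ), ∃ B : ℝ, 0 ≤ B ∧
    ∀ {n : ℕ} {i j : Fin n} (_hij : i ≠ j) {p : Fin n → ℝ} {pmax : ℝ}
      (_hp0 : ∀ k, 0 ≤ p k) (_hpm : ∀ k, p k ≤ pmax) (_hP : 0 < ∑ k ∈ (Finset.univ \ {i, j}), p k) (ω : V3),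
      ∫⁻ v, ENNReal.ofReal (max ⟪ω, v i - v j⟫_ℝ 0 *
          (1 - min 1 (Real.exp (-(
            Real.log (∑ k, p k * localMaxwellian 1 (ϑ ^ 2) (reflectVel ω (v i, v j)).1 (v k)) +
            Real.log (∑ k, p k * localMaxwellian 1 (ϑ ^ 2) (reflectVel ω (v i, v j)).2 (v k)) -
            Real.log (∑ k, p k * localMaxwellian 1 (ϑ ^ 2) (v i) (v k)) -
            Real.log (∑ k, p k * localMaxwellian 1 (ϑ ^ 2) (v j) (v k)))))))
        ∂(Measure.pi fun _ : Fin n => gaussMeasure (0 : V3) θ) ≤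
      ENNReal.ofReal (B * (Real.sqrt (pmax / ∑ k ∈ (Finset.univ \ {i, j}), p k) +
          pmax / ∑ k ∈ (Finset.univ \ {i, j}), p k)) *
        ∫⁻ v, ENNReal.ofReal (max ⟪ω, v i - v j⟫_ℝ 0) ∂(Measure.pi fun _ : Fin n => gaussMeasure (0 : V3) θ) := by
  intro θ ϑ hθ hϑ
  have hϑ2 : 0 < ϑ ^ 2 := by positivity
  have hT : 0 < θ + ϑ ^ 2 := by positivity
  have hT2 : 0 < θ + ϑ ^ 2 / 2 := by positivity
  -- the exponential rate
  set c₀ : ℝ := 1 / (2 * (θ + ϑ ^ 2)) with hc₀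
  have hc₀0 : 0 ≤ c₀ := by positivity
  have h2c : 2 * c₀ * θ = θ / (θ + ϑ ^ 2) := by rw [hc₀]; field_simp
  have hc₀θ : c₀ < 1 / (2 * θ) := by
    rw [hc₀]; exact one_div_lt_one_div_of_lt (by positivity) (by nlinarith)
  have h12 : 0 < 1 - 2 * c₀ * θ := by
    rw [h2c, sub_pos, div_lt_one hT]; linarith
  -- constants
  set m0 : ℝ := localMaxwellian 1 (θ + ϑ ^ 2) (0 : V3) 0 with hm0
  have hm0pos : 0 < m0 := localMaxwellian_pos one_pos hT _ _
  set Cm : ℝ := m0⁻¹ with hCm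
  have hCm0 : 0 ≤ Cm := by positivity
  set φmax : ℝ := localMaxwellian 1 (ϑ ^ 2) (0 : V3) 0 with hφmax
  have hφmax0 : 0 ≤ φmax := localMaxwellian_nonneg zero_le_one hϑ2.le _ _
  set Cs : ℝ := Real.sqrt ((4 * Real.pi * ϑ ^ 2) ^ (-(3 : ℝ) / 2) * localMaxwellian 1 (θ + ϑ ^ 2 / 2) (0 : V3) 0)
    with hCs
  have hCs0 : 0 ≤ Cs := Real.sqrt_nonneg _
  set Cr : ℝ := Cs * Cm with hCr
  have hCr0 : 0 ≤ Cr := by positivity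
  set B₀ : ℝ := 12 * Cr + 8 * φmax * Cm with hB₀
  have hB₀0 : 0 ≤ B₀ := by positivity
  set L : ℝ := (1 - 2 * c₀ * θ) ^ (-(7 : ℝ) / 2) with hL
  have hL0 : 0 ≤ L := Real.rpow_nonneg h12.le _
  refine ⟨B₀ * L, by positivity, ?_⟩
  intro n i j hij p pmax hp0 hpm hP ω
  set γ : Measure V3 := gaussMeasure (0 : V3) θ with hγ
  set μ : Measure (Fin n → V3) := Measure.pi fun _ : Fin n => γ with hμ
  set rest : Finset (Fin n) := Finset.univ \ {i, j} with hrest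
  set P : ℝ := ∑ k ∈ rest, p k with hP_def
  have hpmax : 0 ≤ pmax := (hp0 i).trans (hpm i)
  have hi : i ∉ rest := by simp [hrest]
  have hj : j ∉ rest := by simp [hrest]
  -- functions of the velocity configuration
  set W : (Fin n → V3) → ℝ := fun v => max ⟪ω, v i - v j⟫_ℝ 0 with hW
  have hW0 : ∀ v, 0 ≤ W v := fun v => le_max_right _ _
  have hWc : Continuous W := continuous_fluxFactor ω i j
  set δf : (Fin n → V3) → ℝ := fun v => 1 - min 1 (Real.exp (-(
        Real.log (∑ k, p k * localMaxwellian 1 (ϑ ^ 2) (reflectVel ω (v i, v j)).1 (v k)) +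
        Real.log (∑ k, p k * localMaxwellian 1 (ϑ ^ 2) (reflectVel ω (v i, v j)).2 (v k)) -
        Real.log (∑ k, p k * localMaxwellian 1 (ϑ ^ 2) (v i) (v k)) -
        Real.log (∑ k, p k * localMaxwellian 1 (ϑ ^ 2) (v j) (v k))))) with hδf
  -- restate the goal through `W` and `δf`
  suffices hgoal : ∫⁻ v, ENNReal.ofReal (W v * δf v) ∂μ ≤
      ENNReal.ofReal (B₀ * L * (Real.sqrt (pmax / P) + pmax / P)) * ∫⁻ v, ENNReal.ofReal (W v) ∂μ by
    simpa only [hW, hδf, hμ, hγ, hP_def, hrest] using hgoal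
  clear_value δf
  set Ex : (Fin n → V3) → ℝ := fun v => Real.exp (c₀ * (‖v i‖ ^ 2 + ‖v j‖ ^ 2)) with hEx
  have hEx0 : ∀ v, 0 ≤ Ex v := fun v => (Real.exp_pos _).le
  have hExc : Continuous Ex := by simp only [hEx]; fun_prop
  have hEx_eq : ∀ v, Real.exp ((‖v i‖ ^ 2 + ‖v j‖ ^ 2) / (2 * (θ + ϑ ^ 2))) = Ex v := by
    intro v; simp only [hEx, hc₀]; congr 1; ring
  -- the four query maps
  set qa : (Fin n → V3) → V3 := fun v => (reflectVel ω (v i, v j)).1 with hqa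
  set qb : (Fin n → V3) → V3 := fun v => (reflectVel ω (v i, v j)).2 with hqb
  set qc : (Fin n → V3) → V3 := fun v => v i with hqc
  set qd : (Fin n → V3) → V3 := fun v => v j with hqd
  have hpair : Continuous fun v : Fin n → V3 => (v i, v j) := (continuous_apply i).prodMk (continuous_apply j)
  have hqac : Continuous qa := continuous_fst.comp ((continuous_reflectVel_pair ω).comp hpair)
  have hqbc : Continuous qb := continuous_snd.comp ((continuous_reflectVel_pair ω).comp hpair)
  have hqcc : Continuous qc := continuous_apply i
  have hqdc : Continuous qd := continuous_apply j
  clear_value Ex qa qb qc qd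
  -- query maps only see the pair
  have hdep : ∀ Q ∈ [qa, qb, qc, qd], ∀ v w : Fin n → V3, v i = w i → v j = w j → Q v = Q w := by
    intro Q hQ v w h1 h2
    simp only [List.mem_cons, List.mem_nil_iff, or_false] at hQ
    rcases hQ with rfl | rfl | rfl | rfl <;> simp [hqa, hqb, hqc, hqd, h1, h2]
  have hnorm : ∀ Q ∈ [qa, qb, qc, qd], ∀ v : Fin n → V3, ‖Q v‖ ^ 2 ≤ ‖v i‖ ^ 2 + ‖v j‖ ^ 2 := by
    intro Q hQ v
    obtain ⟨h1, h2, h3, h4⟩ := norm_sq_four_le ω (v i) (v j)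
    simp only [List.mem_cons, List.mem_nil_iff, or_false] at hQ
    rcases hQ with rfl | rfl | rfl | rfl
    · simpa only [hqa] using h1
    · simpa only [hqb] using h2
    · simpa only [hqc] using h3
    · simpa only [hqd] using h4
  -- deviation and spike functionals
  set Δ : ((Fin n → V3) → V3) → (Fin n → V3) → ℝ := fun Q v =>
    (∑ k ∈ rest, p k * localMaxwellian 1 (ϑ ^ 2) (Q v) (v k)) / (P * localMaxwellian 1 (θ + ϑ ^ 2) 0 (Q v)) - 1
    with hΔ
  set sp : ((Fin n → V3) → V3) → (Fin n → V3) → ℝ := fun Q v =>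
    (p i + p j) * φmax / (P * localMaxwellian 1 (θ + ϑ ^ 2) 0 (Q v)) with hsp
  have hsp0 : ∀ Q v, 0 ≤ sp Q v := fun Q v =>
    div_nonneg (mul_nonneg (add_nonneg (hp0 i) (hp0 j)) hφmax0)
      (mul_pos hP (localMaxwellian_pos one_pos hT _ _)).le
  clear_value Δ sp
  -- Step A: the pointwise bound
  have hpt : ∀ v, δf v ≤
      4 * |Δ qa v| + 4 * |Δ qb v| + 2 * |Δ qc v| + 2 * |Δ qd v| + 2 * sp qa v + 2 * sp qb v := by
    intro v
    have := defect_pointwise_le hθ hϑ hij hp0 hP ω v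
    simp only [hδf, hΔ, hsp, hqa, hqb, hqc, hqd, hφmax, hP_def, hrest]
    linarith
  -- continuity of the deviation / spike functionals
  have hΔc : ∀ {Q : (Fin n → V3) → V3}, Continuous Q → Continuous (Δ Q) := by
    intro Q hQ
    simp only [hΔ]
    exact continuous_dev hθ hϑ rest p hP hQ
  have hmQc : ∀ {Q : (Fin n → V3) → V3}, Continuous Q →
      Continuous fun v => localMaxwellian 1 (θ + ϑ ^ 2) (0 : V3) (Q v) := by
    intro Q hQ
    show Continuous fun v : Fin n → V3 => localMaxwellian 1 (θ + ϑ ^ 2) 0 (Q v)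
    unfold localMaxwellian; fun_prop
  have hspc : ∀ {Q : (Fin n → V3) → V3}, Continuous Q → Continuous (sp Q) := by
    intro Q hQ
    simp only [hsp]
    refine continuous_const.div (continuous_const.mul (hmQc hQ)) fun v => ?_
    exact (mul_pos hP (localMaxwellian_pos one_pos hT _ _)).ne'
  have hmeasΔ : ∀ {Q : (Fin n → V3) → V3}, Continuous Q → ∀ κ : ℝ,
      Measurable fun v => ENNReal.ofReal (W v * (κ * |Δ Q v|)) := fun hQ κ =>
    (hWc.mul (continuous_const.mul (hΔc hQ).abs)).measurable.ennreal_ofReal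
  have hmeassp : ∀ {Q : (Fin n → V3) → V3}, Continuous Q →
      Measurable fun v => ENNReal.ofReal (W v * (2 * sp Q v)) := fun hQ =>
    (hWc.mul (continuous_const.mul (hspc hQ))).measurable.ennreal_ofReal
  have hmeasWE : Measurable fun v => ENNReal.ofReal (W v * Ex v) := (hWc.mul hExc).measurable.ennreal_ofReal
  -- coordinates outside `rest` are untouched by `updateFinset`
  have hupd : ∀ (x : Fin n → V3) (y : (k : rest) → V3),
      updateFinset x rest y i = x i ∧ updateFinset x rest y j = x j := fun x y =>
    ⟨by simp [updateFinset, hi], by simp [updateFinset, hj]⟩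
  -- the tilted exponential moment (K1d)
  set X : ℝ≥0∞ := ∫⁻ v, ENNReal.ofReal (W v * Ex v) ∂μ with hX
  have hXeq : X = ENNReal.ofReal L * ∫⁻ v, ENNReal.ofReal (W v) ∂μ := by
    simp only [hX, hW, hEx, hL, hμ, hγ]
    exact hD hθ hc₀0 hc₀θ hij ω
  -- Step D1: the deviation terms
  have hD1 : ∀ Q ∈ [qa, qb, qc, qd], Continuous Q → ∀ κ : ℝ, 0 ≤ κ →
      ∫⁻ v, ENNReal.ofReal (W v * (κ * |Δ Q v|)) ∂μ ≤ ENNReal.ofReal (κ * Real.sqrt (pmax / P) * Cr) * X := by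
    intro Q hQ hQc κ hκ
    have hcmp : ∫⁻ v, ENNReal.ofReal (W v * (κ * |Δ Q v|)) ∂μ ≤
        ∫⁻ v, ENNReal.ofReal (κ * Real.sqrt (pmax / P) * Cr) * ENNReal.ofReal (W v * Ex v) ∂μ := by
      refine lintegral_le_of_lmarginal_le (μ := fun _ : Fin n => γ) rest (hmeasΔ hQc κ)
        (hmeasWE.const_mul _) fun x => ?_
      obtain hQx : ∀ y, Q (updateFinset x rest y) = Q x := fun y =>
        hdep Q hQ _ _ (hupd x y).1 (hupd x y).2
      -- left-hand marginal
      have hL : (∫⋯∫⁻_rest, (fun v => ENNReal.ofReal (W v * (κ * |Δ Q v|))) ∂fun _ : Fin n => γ) x =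
          ENNReal.ofReal (W x * κ) * ∫⁻ y : (k : rest) → V3, ENNReal.ofReal
            |(∑ k ∈ rest, p k * localMaxwellian 1 (ϑ ^ 2) (Q x) (updateFinset x rest y k)) /
                ((∑ k ∈ rest, p k) * localMaxwellian 1 (θ + ϑ ^ 2) 0 (Q x)) - 1|
            ∂(Measure.pi fun _ : rest => γ) := by
        rw [lmarginal, ← lintegral_const_mul' _ _ ENNReal.ofReal_ne_top]
        refine lintegral_congr fun y => ?_
        rw [← ENNReal.ofReal_mul (mul_nonneg (hW0 x) hκ)]
        congr 1
        simp only [hW, hΔ, hQx y, (hupd x y).1, (hupd x y).2, hP_def]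
        ring
      -- right-hand marginal
      have hR : (∫⋯∫⁻_rest, (fun v => ENNReal.ofReal (κ * Real.sqrt (pmax / P) * Cr) * ENNReal.ofReal (W v * Ex v))
            ∂fun _ : Fin n => γ) x = ENNReal.ofReal (κ * Real.sqrt (pmax / P) * Cr) * ENNReal.ofReal (W x * Ex x) := by
        rw [lmarginal]
        have : ∀ y : (k : rest) → V3, ENNReal.ofReal (κ * Real.sqrt (pmax / P) * Cr) *
            ENNReal.ofReal (W (updateFinset x rest y) * Ex (updateFinset x rest y)) =
            ENNReal.ofReal (κ * Real.sqrt (pmax / P) * Cr) * ENNReal.ofReal (W x * Ex x) := by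
          intro y; simp only [hW, hEx, (hupd x y).1, (hupd x y).2]
        simp_rw [this]
        rw [lintegral_const, measure_univ, mul_one]
      rw [hL, hR]
      -- K1b + the Gaussian growth bound
      have h1 := lmarginal_dev_le hB hθ hϑ rest hp0 hpm hP (Q x) x
      have h2 : Real.sqrt (pmax / ∑ k ∈ rest, p k) *
          (Real.sqrt ((4 * Real.pi * ϑ ^ 2) ^ (-(3 : ℝ) / 2) * localMaxwellian 1 (θ + ϑ ^ 2 / 2) 0 (Q x)) /
            localMaxwellian 1 (θ + ϑ ^ 2) 0 (Q x)) ≤ Real.sqrt (pmax / P) * (Cr * Ex x) := by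
        rw [← hP_def]
        refine mul_le_mul_of_nonneg_left ?_ (Real.sqrt_nonneg _)
        have := devScale_le (T := θ + ϑ ^ 2) (T' := θ + ϑ ^ 2 / 2) (C := (4 * Real.pi * ϑ ^ 2) ^ (-(3 : ℝ) / 2))
          hT hT2 (Real.rpow_nonneg (by positivity) _) (hnorm Q hQ x)
        rw [hEx_eq x] at this
        simpa only [hCr, hCs, hCm, hm0, mul_assoc] using this
      calc ENNReal.ofReal (W x * κ) * ∫⁻ y : (k : rest) → V3, ENNReal.ofReal
            |(∑ k ∈ rest, p k * localMaxwellian 1 (ϑ ^ 2) (Q x) (updateFinset x rest y k)) /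
                ((∑ k ∈ rest, p k) * localMaxwellian 1 (θ + ϑ ^ 2) 0 (Q x)) - 1| ∂(Measure.pi fun _ : rest => γ)
          ≤ ENNReal.ofReal (W x * κ) * ENNReal.ofReal (Real.sqrt (pmax / P) * (Cr * Ex x)) :=
            mul_le_mul' le_rfl (h1.trans (ENNReal.ofReal_le_ofReal h2))
        _ = ENNReal.ofReal (κ * Real.sqrt (pmax / P) * Cr) * ENNReal.ofReal (W x * Ex x) := by
            rw [← ENNReal.ofReal_mul (mul_nonneg (hW0 x) hκ), ← ENNReal.ofReal_mul (by positivity)]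
            congr 1; ring
    refine hcmp.trans_eq ?_
    rw [lintegral_const_mul' _ _ ENNReal.ofReal_ne_top]
  -- Step D2: the spike terms
  set S' : ℝ := (p i + p j) * φmax with hS'
  have hS'0 : 0 ≤ S' := mul_nonneg (add_nonneg (hp0 i) (hp0 j)) hφmax0
  have hS'le : S' ≤ 2 * pmax * φmax := by
    rw [hS']; nlinarith [hpm i, hpm j, hφmax0]
  have hD2 : ∀ Q ∈ [qa, qb, qc, qd], Continuous Q →
      ∫⁻ v, ENNReal.ofReal (W v * (2 * sp Q v)) ∂μ ≤ ENNReal.ofReal (2 * (S' / P) * Cm) * X := by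
    intro Q hQ hQc
    have hpt2 : ∀ v, W v * (2 * sp Q v) ≤ 2 * (S' / P) * Cm * (W v * Ex v) := by
      intro v
      have := spike_div_le (T := θ + ϑ ^ 2) hT hP hS'0 (hnorm Q hQ v)
      rw [hEx_eq v] at this
      have h3 : sp Q v ≤ S' / P * Cm * Ex v := by simpa only [hsp, hS', hCm, hm0] using this
      have := mul_le_mul_of_nonneg_left h3 (hW0 v)
      nlinarith [hW0 v]
    calc ∫⁻ v, ENNReal.ofReal (W v * (2 * sp Q v)) ∂μ
        ≤ ∫⁻ v, ENNReal.ofReal (2 * (S' / P) * Cm) * ENNReal.ofReal (W v * Ex v) ∂μ := by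
          refine lintegral_mono fun v => ?_
          rw [← ENNReal.ofReal_mul (by positivity)]
          exact ENNReal.ofReal_le_ofReal (hpt2 v)
      _ = ENNReal.ofReal (2 * (S' / P) * Cm) * X := by rw [lintegral_const_mul' _ _ ENNReal.ofReal_ne_top]
  -- Steps B/C: split the pointwise majorant and integrate
  have hqa_mem : qa ∈ [qa, qb, qc, qd] := by simp
  have hqb_mem : qb ∈ [qa, qb, qc, qd] := by simp
  have hqc_mem : qc ∈ [qa, qb, qc, qd] := by simp
  have hqd_mem : qd ∈ [qa, qb, qc, qd] := by simp
  -- pointwise split of the majorant into six non-negative pieces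
  have hstep1 : ∀ v, ENNReal.ofReal (W v * δf v) ≤
      ENNReal.ofReal (W v * (4 * |Δ qa v|)) + (ENNReal.ofReal (W v * (4 * |Δ qb v|)) +
        (ENNReal.ofReal (W v * (2 * |Δ qc v|)) + (ENNReal.ofReal (W v * (2 * |Δ qd v|)) +
        (ENNReal.ofReal (W v * (2 * sp qa v)) + ENNReal.ofReal (W v * (2 * sp qb v)))))) := by
    intro v
    have hw := hW0 v
    have hle := mul_le_mul_of_nonneg_left (hpt v) hw
    refine (ENNReal.ofReal_le_ofReal hle).trans_eq ?_
    have n1 : 0 ≤ W v * (4 * |Δ qa v|) := mul_nonneg hw (mul_nonneg (by norm_num) (abs_nonneg _))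
    have n2 : 0 ≤ W v * (4 * |Δ qb v|) := mul_nonneg hw (mul_nonneg (by norm_num) (abs_nonneg _))
    have n3 : 0 ≤ W v * (2 * |Δ qc v|) := mul_nonneg hw (mul_nonneg (by norm_num) (abs_nonneg _))
    have n4 : 0 ≤ W v * (2 * |Δ qd v|) := mul_nonneg hw (mul_nonneg (by norm_num) (abs_nonneg _))
    have n5 : 0 ≤ W v * (2 * sp qa v) := mul_nonneg hw (mul_nonneg (by norm_num) (hsp0 qa v))
    have n6 : 0 ≤ W v * (2 * sp qb v) := mul_nonneg hw (mul_nonneg (by norm_num) (hsp0 qb v))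
    rw [← ENNReal.ofReal_add n5 n6, ← ENNReal.ofReal_add n4 (add_nonneg n5 n6),
      ← ENNReal.ofReal_add n3 (add_nonneg n4 (add_nonneg n5 n6)),
      ← ENNReal.ofReal_add n2 (add_nonneg n3 (add_nonneg n4 (add_nonneg n5 n6))),
      ← ENNReal.ofReal_add n1 (add_nonneg n2 (add_nonneg n3 (add_nonneg n4 (add_nonneg n5 n6))))]
    congr 1; ring
  have hmain : ∫⁻ v, ENNReal.ofReal (W v * δf v) ∂μ ≤
      (ENNReal.ofReal (4 * Real.sqrt (pmax / P) * Cr) + ENNReal.ofReal (4 * Real.sqrt (pmax / P) * Cr) +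
        ENNReal.ofReal (2 * Real.sqrt (pmax / P) * Cr) + ENNReal.ofReal (2 * Real.sqrt (pmax / P) * Cr) +
        ENNReal.ofReal (2 * (S' / P) * Cm) + ENNReal.ofReal (2 * (S' / P) * Cm)) * X := by
    calc ∫⁻ v, ENNReal.ofReal (W v * δf v) ∂μ
        ≤ ∫⁻ v, (ENNReal.ofReal (W v * (4 * |Δ qa v|)) + (ENNReal.ofReal (W v * (4 * |Δ qb v|)) +
            (ENNReal.ofReal (W v * (2 * |Δ qc v|)) + (ENNReal.ofReal (W v * (2 * |Δ qd v|)) +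
            (ENNReal.ofReal (W v * (2 * sp qa v)) + ENNReal.ofReal (W v * (2 * sp qb v))))))) ∂μ :=
          lintegral_mono fun v => hstep1 v
      _ = ∫⁻ v, ENNReal.ofReal (W v * (4 * |Δ qa v|)) ∂μ + (∫⁻ v, ENNReal.ofReal (W v * (4 * |Δ qb v|)) ∂μ +
            (∫⁻ v, ENNReal.ofReal (W v * (2 * |Δ qc v|)) ∂μ + (∫⁻ v, ENNReal.ofReal (W v * (2 * |Δ qd v|)) ∂μ +
            (∫⁻ v, ENNReal.ofReal (W v * (2 * sp qa v)) ∂μ + ∫⁻ v, ENNReal.ofReal (W v * (2 * sp qb v)) ∂μ)))) := by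
          rw [lintegral_add_left (hmeasΔ hqac 4), lintegral_add_left (hmeasΔ hqbc 4), lintegral_add_left (hmeasΔ hqcc 2),
            lintegral_add_left (hmeasΔ hqdc 2), lintegral_add_left (hmeassp hqac)]
      _ ≤ ENNReal.ofReal (4 * Real.sqrt (pmax / P) * Cr) * X + (ENNReal.ofReal (4 * Real.sqrt (pmax / P) * Cr) * X +
            (ENNReal.ofReal (2 * Real.sqrt (pmax / P) * Cr) * X + (ENNReal.ofReal (2 * Real.sqrt (pmax / P) * Cr) * X +
            (ENNReal.ofReal (2 * (S' / P) * Cm) * X + ENNReal.ofReal (2 * (S' / P) * Cm) * X)))) := by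
          gcongr
          · exact hD1 qa hqa_mem hqac 4 (by norm_num)
          · exact hD1 qb hqb_mem hqbc 4 (by norm_num)
          · exact hD1 qc hqc_mem hqcc 2 (by norm_num)
          · exact hD1 qd hqd_mem hqdc 2 (by norm_num)
          · exact hD2 qa hqa_mem hqac
          · exact hD2 qb hqb_mem hqbc
      _ = _ := by ring
  -- Step E: collect the constants
  refine hmain.trans ?_
  rw [hXeq, ← mul_assoc]
  refine mul_le_mul' ?_ le_rfl
  have hsq0 : 0 ≤ Real.sqrt (pmax / P) := Real.sqrt_nonneg _
  have hrat0 : 0 ≤ pmax / P := div_nonneg hpmax hP.le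
  have hSP0 : 0 ≤ S' / P := div_nonneg hS'0 hP.le
  have k1 : 0 ≤ 4 * Real.sqrt (pmax / P) * Cr := mul_nonneg (mul_nonneg (by norm_num) hsq0) hCr0
  have k2 : 0 ≤ 2 * Real.sqrt (pmax / P) * Cr := mul_nonneg (mul_nonneg (by norm_num) hsq0) hCr0
  have k3 : 0 ≤ 2 * (S' / P) * Cm := mul_nonneg (mul_nonneg (by norm_num) hSP0) hCm0
  have k11 := add_nonneg k1 k1
  have k112 := add_nonneg k11 k2
  have k1122 := add_nonneg k112 k2
  have k11223 := add_nonneg k1122 k3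
  have k112233 := add_nonneg k11223 k3
  rw [← ENNReal.ofReal_add k1 k1, ← ENNReal.ofReal_add k11 k2, ← ENNReal.ofReal_add k112 k2,
    ← ENNReal.ofReal_add k1122 k3, ← ENNReal.ofReal_add k11223 k3, ← ENNReal.ofReal_mul k112233]
  refine ENNReal.ofReal_le_ofReal ?_
  have hkey : 12 * Real.sqrt (pmax / P) * Cr + 4 * (S' / P) * Cm ≤ B₀ * (Real.sqrt (pmax / P) + pmax / P) := by
    have e1 : 4 * (S' / P) * Cm ≤ 8 * φmax * Cm * (pmax / P) := by
      have : S' / P ≤ 2 * pmax * φmax / P := div_le_div_of_nonneg_right hS'le hP.le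
      have h4 : 4 * (S' / P) * Cm ≤ 4 * (2 * pmax * φmax / P) * Cm :=
        mul_le_mul_of_nonneg_right (mul_le_mul_of_nonneg_left this (by norm_num)) hCm0
      refine h4.trans_eq ?_
      rw [mul_div_assoc]
      ring
    rw [hB₀]
    have hexp : (12 * Cr + 8 * φmax * Cm) * (Real.sqrt (pmax / P) + pmax / P) =
        12 * Real.sqrt (pmax / P) * Cr + 8 * φmax * Cm * (pmax / P) +
          (12 * Cr * (pmax / P) + 8 * φmax * Cm * Real.sqrt (pmax / P)) := by ring
    have hnn : 0 ≤ 12 * Cr * (pmax / P) + 8 * φmax * Cm * Real.sqrt (pmax / P) :=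
      add_nonneg (mul_nonneg (mul_nonneg (by norm_num) hCr0) hrat0)
        (mul_nonneg (mul_nonneg (mul_nonneg (by norm_num) hφmax0) hCm0) hsq0)
    rw [hexp]
    linarith
  calc (4 * Real.sqrt (pmax / P) * Cr + 4 * Real.sqrt (pmax / P) * Cr + 2 * Real.sqrt (pmax / P) * Cr +
        2 * Real.sqrt (pmax / P) * Cr + 2 * (S' / P) * Cm + 2 * (S' / P) * Cm) * L
      = (12 * Real.sqrt (pmax / P) * Cr + 4 * (S' / P) * Cm) * L := by ring
    _ ≤ B₀ * (Real.sqrt (pmax / P) + pmax / P) * L := mul_le_mul_of_nonneg_right hkey hL0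
    _ = B₀ * L * (Real.sqrt (pmax / P) + pmax / P) := by ring

/-- **K1 `stub_kdeDefectPair` — the velocity-level Maxwell-defect bound** (registered piece of P4): assembled from the landed
K1a `stub_gaussKernelMoments`, K1b `stub_weightedKdeDev_of`, K1d `stub_tiltedPairExpMoment` through `kdeDefectPair_of`. [folklore] -/
theorem stub_kdeDefectPair :
    ∀ {θ ϑ : ℝ} (_hθ : 0 < θ) (_hϑ : 0 < ϑ), ∃ B : ℝ, 0 ≤ B ∧
    ∀ {n : ℕ} {i j : Fin n} (_hij : i ≠ j) {p : Fin n → ℝ} {pmax : ℝ}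
      (_hp0 : ∀ k, 0 ≤ p k) (_hpm : ∀ k, p k ≤ pmax) (_hP : 0 < ∑ k ∈ (Finset.univ \ {i, j}), p k) (ω : V3),
      ∫⁻ v, ENNReal.ofReal (max ⟪ω, v i - v j⟫_ℝ 0 *
          (1 - min 1 (Real.exp (-(
            Real.log (∑ k, p k * localMaxwellian 1 (ϑ ^ 2) (reflectVel ω (v i, v j)).1 (v k)) +
            Real.log (∑ k, p k * localMaxwellian 1 (ϑ ^ 2) (reflectVel ω (v i, v j)).2 (v k)) -
            Real.log (∑ k, p k * localMaxwellian 1 (ϑ ^ 2) (v i) (v k)) -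
            Real.log (∑ k, p k * localMaxwellian 1 (ϑ ^ 2) (v j) (v k)))))))
        ∂(Measure.pi fun _ : Fin n => gaussMeasure (0 : V3) θ) ≤
      ENNReal.ofReal (B * (Real.sqrt (pmax / ∑ k ∈ (Finset.univ \ {i, j}), p k) +
          pmax / ∑ k ∈ (Finset.univ \ {i, j}), p k)) *
        ∫⁻ v, ENNReal.ofReal (max ⟪ω, v i - v j⟫_ℝ 0) ∂(Measure.pi fun _ : Fin n => gaussMeasure (0 : V3) θ) :=
  kdeDefectPair_of (stub_weightedKdeDev_of stub_gaussKernelMoments) stub_tiltedPairExpMoment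

end Summit.AtomisticToContinuum.HydrodynamicLimit.Theorems.OddContactSymmetryKineticSlab

end
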